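import Literature.MathematicalPhysics.QuantumLattice.TorusSectorPressureStaircase
import Literature.InformationTheory.Entropy.MultinomialBound
import HarnessLib

/-!
# The certificate-free `β = 0` anchor of the β-staircase: `log Z_0^{sector}(L) ≥ (2 H_b(n/2) − ε) L²`

Topic `MathematicalPhysics/QuantumLattice`; companion of `TorusSectorPressureStaircase.lean`. At `β = 0` the
canonical sector partition function is the sector DIMENSION `#{(N↑, N↓) = (k, k)} = C(L², k)²`, `k = ⌊nL²/2⌋`
(`TorusSectorGibbsMixture.lean` proves the upper bound `≤ C(L²,k)²` and `log # ≤ 2 L² H_b(k/L²)`). Here the lower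
half: the configurations `pairSet A B` with `|A| = |B| = k` exhaust the count from below, and the type-class
lower bound of the binomial coefficient (`Literature.InformationTheory.Entropy.le_log_multinomial`,
Csiszár–Körner Lemma 2.3) gives `log C(m, k) ≥ m H_b(k/m) − 2 log(m+1)`; continuity of `H_b` at `n/2` then gives,
for every `s < 2 H_b(n/2)`, eventually `s L² ≤ log #sector_L = log Re Z_0(sectorHamiltonianTT' t t' U n L)`.

* `choose_sq_le_sectorGibbsCount`, `sectorGibbsCount_eq_choose_sq` — `#sector = C(L²,k)²`;
* `le_log_choose` — `m H_b(k/m) − 2 log(m+1) ≤ log C(m,k)`;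
* `eventually_le_log_sectorGibbsCount` — `s < 2H_b(n/2)` ⇒ eventually `s L² ≤ log #sector_L`;
* `eventually_pressureFloor_zero` — the `β = 0` anchor in the staircase's `hW` shape:
  `∀ ε > 0, ∀ᶠ j, (2 H_b(n/2) − ε)(Ls j)² ≤ log Re Z_0(sectorHamiltonianTT' t t' U n (Ls j))` — so the β-staircase
  `eventually_pressureFloor_staircase` can be anchored at infinite temperature WITHOUT any certificate
  (`W₀ = 2 H_b(n/2)`, `= 1.3706…` at `n = 7/8`).

Everything is PROVED; no definition, no named fact.

References: Csiszár–Körner 2011 Lemma 2.3 / Cover–Thomas 2006 Thm. 11.1.3 [CsiszarKorner2011, CoverThomas2006];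
Israel 1979 Lemma II.3.1 [Israel1979]; Lieb 1989 (sector bookkeeping) [LiebPRL1989].
-/

noncomputable section

namespace Literature.MathematicalPhysics.QuantumLattice

open Matrix Finset HubbardWave0 ThermodynamicLimit Literature.Probability.LatticeModels
open Literature.InformationTheory.Entropy (le_log_multinomial)
open _root_.Filter
open scoped _root_.Topology ComplexOrder BigOperators

/-! ### §1 The sector dimension is `C(L², k)²` -/

/-- **`C(L², k)² ≤ #sector`**, `k = ⌊nL²/2⌋`: the configurations with up-set `A` and down-set `B`, `|A| = |B| = k`,
are distinct sector configurations (`pairSet`, `upPart_pairSet`, `downPart_pairSet`). [cite: LiebPRL1989, proof of Theorem 1] -/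
theorem choose_sq_le_sectorGibbsCount (n : ℝ) (L : ℕ) :
    ((L ^ 2).choose (halfRectN n L)) ^ 2 ≤ sectorGibbsCount n L := by
  classical
  set k := halfRectN n L with hk
  let g : {α : Finset (FermionTorus 2 L) // α.card = k} × {β : Finset (FermionTorus 2 L) // β.card = k} →
      Subtype (szConfig n L) :=
    fun p => ⟨pairSet p.1.1 p.2.1, by
      constructor
      · rw [upPart_pairSet]; exact p.1.2
      · rw [downPart_pairSet]; exact p.2.2⟩
  have hg : Function.Injective g := by
    rintro ⟨⟨A, hA⟩, ⟨B, hB⟩⟩ ⟨⟨A', hA'⟩, ⟨B', hB'⟩⟩ h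
    have h' : pairSet A B = pairSet A' B' := congrArg Subtype.val h
    have hA1 : A = A' := by
      have := congrArg upPart h'; rwa [upPart_pairSet, upPart_pairSet] at this
    have hB1 : B = B' := by
      have := congrArg downPart h'; rwa [downPart_pairSet, downPart_pairSet] at this
    subst hA1 hB1
    rfl
  have hcard := Fintype.card_le_of_injective g hg
  rw [Fintype.card_prod, Fintype.card_finset_len] at hcard
  have hΛ : Fintype.card (FermionTorus 2 L) = L ^ 2 := by simp [FermionTorus, sq]
  rw [hΛ, ← sq] at hcard
  exact hcard

/-- **`#sector = C(L², k)²`.** [cite: LiebPRL1989, proof of Theorem 1] -/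
theorem sectorGibbsCount_eq_choose_sq (n : ℝ) (L : ℕ) :
    sectorGibbsCount n L = ((L ^ 2).choose (halfRectN n L)) ^ 2 :=
  le_antisymm (sectorGibbsCount_le_choose_sq n L) (choose_sq_le_sectorGibbsCount n L)

/-! ### §2 The binomial coefficient from below -/

/-- **`m·H_b(k/m) − 2·log(m+1) ≤ log C(m, k)`** (`k ≤ m`, `0 < m`): the two-letter case of the type-class
lower bound `k H(P) − |ι| log(k+1) ≤ log(k!/∏ lᵢ!)`. [cite: CsiszarKorner2011, Ch. 2, Lemma 2.3]
[cite: CoverThomas2006, Theorem 11.1.3] -/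
theorem le_log_choose {m k : ℕ} (hkm : k ≤ m) (hm : 0 < m) :
    (m : ℝ) * Real.binEntropy ((k : ℝ) / m) - 2 * Real.log ((m : ℝ) + 1) ≤ Real.log (m.choose k) := by
  set l : Fin 2 → ℕ := ![k, m - k] with hl
  have hsum : ∑ i, l i = m := by
    rw [Fin.sum_univ_two]
    show k + (m - k) = m
    omega
  have hpos : 0 < ∑ i, l i := by rw [hsum]; exact hm
  have h := le_log_multinomial l hpos
  rw [hsum, Fintype.card_fin] at h
  have hprod : ∏ i, ((l i).factorial : ℝ) = (k.factorial : ℝ) * ((m - k).factorial : ℝ) := by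
    rw [Fin.prod_univ_two]; rfl
  have hmulti : Real.log ((m.factorial : ℝ) / ∏ i, ((l i).factorial : ℝ)) = Real.log (m.choose k) := by
    rw [hprod, Nat.cast_choose ℝ hkm]
  have hent : ∑ i, Real.negMulLog ((l i : ℝ) / (m : ℕ)) = Real.binEntropy ((k : ℝ) / m) := by
    rw [Fin.sum_univ_two, Real.binEntropy_eq_negMulLog_add_negMulLog_one_sub]
    have hmR : (m : ℝ) ≠ 0 := Nat.cast_ne_zero.2 hm.ne'
    have e1 : ((l 1 : ℕ) : ℝ) / (m : ℕ) = 1 - (k : ℝ) / m := by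
      show (((m - k : ℕ) : ℝ)) / (m : ℝ) = 1 - (k : ℝ) / m
      rw [Nat.cast_sub hkm]
      field_simp
    rw [e1]
    rfl
  rw [hmulti, hent] at h
  have e2 : ((2 : ℕ) : ℝ) = 2 := by norm_num
  rw [e2] at h
  exact h

/-! ### §3 Eventually `s L² ≤ log #sector_L` for `s < 2 H_b(n/2)` -/

/-- `k_L/L² → n/2` (the sector filling fraction converges; re-derived, private upstream). [folklore] -/
private theorem tendsto_halfRectN_div_sq' {n : ℝ} (hn0 : 0 ≤ n) :
    Tendsto (fun L : ℕ => (halfRectN n L : ℝ) / (L : ℝ) ^ 2) atTop (𝓝 (n / 2)) := by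
  have h := (tendsto_rectN_div_sq hn0).div_const 2
  refine h.congr fun L => ?_
  have e : rectN n L = 2 * halfRectN n L := rfl
  rw [e]
  push_cast
  ring

/-- **Eventually `s·L² ≤ log #sector_L` for every `s < 2 H_b(n/2)`** (`0 ≤ n ≤ 2`): `log #sector = 2 log C(L²,k_L) ≥
2 L² H_b(k_L/L²) − 4 log(L²+1)`, `H_b(k_L/L²) → H_b(n/2)`, `log(L²+1) = o(L²)`. [cite: Israel1979, Lemma II.3.1]
[cite: CoverThomas2006, Theorem 11.1.3] -/
theorem eventually_le_log_sectorGibbsCount {n : ℝ} (hn0 : 0 ≤ n) (hn2 : n ≤ 2) {s : ℝ}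
    (hs : s < 2 * Real.binEntropy (n / 2)) :
    ∀ᶠ L : ℕ in atTop, s * (L : ℝ) ^ 2 ≤ Real.log (sectorGibbsCount n L) := by
  -- margin
  set δ : ℝ := (2 * Real.binEntropy (n / 2) - s) / 2 with hδ
  have hδpos : 0 < δ := by rw [hδ]; linarith
  -- continuity of the binary entropy along `k_L/L² → n/2`
  have hcont : Tendsto (fun L : ℕ => 2 * Real.binEntropy ((halfRectN n L : ℝ) / (L : ℝ) ^ 2)) atTop
      (𝓝 (2 * Real.binEntropy (n / 2))) :=
    ((Real.binEntropy_continuous.tendsto _).comp (tendsto_halfRectN_div_sq' hn0)).const_mul 2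
  have hev1 : ∀ᶠ L : ℕ in atTop, s + δ < 2 * Real.binEntropy ((halfRectN n L : ℝ) / (L : ℝ) ^ 2) :=
    hcont.eventually (lt_mem_nhds (by rw [hδ]; linarith))
  -- `4 log(L²+1) ≤ δ L²` eventually
  have hev2 : ∀ᶠ L : ℕ in atTop, 4 * Real.log ((L : ℝ) ^ 2 + 1) ≤ δ * (L : ℝ) ^ 2 := by
    have h2 : Tendsto (fun L : ℕ => (L : ℝ) ^ 2 + 1) atTop atTop :=
      tendsto_atTop_add_const_right _ 1 ((tendsto_pow_atTop two_ne_zero).comp tendsto_natCast_atTop_atTop)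
    set c : ℝ := δ / 8 with hc
    have hcpos : 0 < c := by positivity
    have h3 := h2.eventually (Real.isLittleO_log_id_atTop.def hcpos)
    filter_upwards [h3, eventually_ge_atTop 1] with L hL hL1
    have hL1' : (1 : ℝ) ≤ (L : ℝ) ^ 2 := by
      have : (1 : ℝ) ≤ (L : ℝ) := by exact_mod_cast hL1
      nlinarith
    have hpos : 0 < (L : ℝ) ^ 2 + 1 := by positivity
    have hlogle : Real.log ((L : ℝ) ^ 2 + 1) ≤ c * ((L : ℝ) ^ 2 + 1) := by
      rwa [id, Real.norm_eq_abs, Real.norm_eq_abs, abs_of_nonneg (Real.log_nonneg (by linarith)),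
        abs_of_pos hpos] at hL
    calc 4 * Real.log ((L : ℝ) ^ 2 + 1) ≤ 4 * (c * ((L : ℝ) ^ 2 + 1)) := by linarith
      _ = δ / 2 * ((L : ℝ) ^ 2 + 1) := by rw [hc]; ring
      _ ≤ δ * (L : ℝ) ^ 2 := by nlinarith
  filter_upwards [hev1, hev2, eventually_ge_atTop 1] with L h1 h2 hL1
  have hm : 0 < L ^ 2 := by positivity
  have hk : halfRectN n L ≤ L ^ 2 := by
    have h := ThermodynamicLimit.rectN_le_two_mul hn0 hn2 L
    have e : rectN n L = 2 * halfRectN n L := rfl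
    rw [e, sq] at *
    exact Nat.le_of_mul_le_mul_left h two_pos
  have hchoose := le_log_choose hk hm
  have hcast : ((L ^ 2 : ℕ) : ℝ) = (L : ℝ) ^ 2 := by push_cast; ring
  rw [hcast] at hchoose
  have hcount : Real.log (sectorGibbsCount n L) = 2 * Real.log ((L ^ 2).choose (halfRectN n L)) := by
    rw [sectorGibbsCount_eq_choose_sq, Nat.cast_pow, Real.log_pow]; norm_num
  rw [hcount]
  have hL2 : (0 : ℝ) ≤ (L : ℝ) ^ 2 := sq_nonneg _
  have h1' : (s + δ) * (L : ℝ) ^ 2 ≤ 2 * Real.binEntropy ((halfRectN n L : ℝ) / (L : ℝ) ^ 2) * (L : ℝ) ^ 2 :=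
    mul_le_mul_of_nonneg_right h1.le hL2
  nlinarith

/-! ### §4 The `β = 0` anchor of the staircase -/

/-- **The infinite-temperature anchor**: for `0 ≤ n ≤ 2` and any `Ls → ∞`, the pressure-floor hypothesis of the
β-staircase holds at `b₀ = 0` with `W₀ = 2 H_b(n/2)` and no certificate:
`∀ ε > 0, ∀ᶠ j, (2 H_b(n/2) − ε)(Ls j)² ≤ log Re Z_0(sectorHamiltonianTT' t t' U n (Ls j))` (`Z_0 = #sector`).
[cite: Israel1979, Lemma II.3.1] [cite: CoverThomas2006, Theorem 11.1.3] -/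
theorem eventually_pressureFloor_zero (t t' U : ℝ) {n : ℝ} (hn0 : 0 ≤ n) (hn2 : n ≤ 2) {Ls : ℕ → ℕ}
    (hLs : Tendsto Ls atTop atTop) {ε : ℝ} (hε : 0 < ε) :
    ∀ᶠ j in atTop, (2 * Real.binEntropy (n / 2) - ε) * (Ls j : ℝ) ^ 2 ≤
      Real.log (partitionFn 0 (sectorHamiltonianTT' t t' U n (Ls j))).re := by
  have h := hLs.eventually (eventually_le_log_sectorGibbsCount hn0 hn2 (s := 2 * Real.binEntropy (n / 2) - ε)
    (by linarith))
  filter_upwards [h] with j hj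
  rw [partitionFn_zero_re]
  exact hj

/-- **The β-staircase anchored at infinite temperature.** `0 ≤ n ≤ 2`, `Ls → ∞`, grid `b` monotone with
`b 0 = 0`, caps `e⁺_i` on every torus limit at `b i` (`i < N`): for every `ε > 0`, eventually
`(2 H_b(n/2) − Σ_{i<N} (b_{i+1} − b_i)·e⁺_i − ε)(Ls j)² ≤ log Re Z_{b N}(Ls j)` — a certified free-energy input
`f⁺(b_N) = (Σ_i Δ_i e⁺_i − 2 H_b(n/2))/b_N` carrying the thermodynamic entropy, built from energy caps alone.
[cite: GustafsonSigal2003, §18.3] [cite: Israel1979, Lemma II.3.1] -/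
theorem eventually_pressureFloor_staircase_zero (t t' U : ℝ) {n : ℝ} (hn0 : 0 ≤ n) (hn2 : n ≤ 2)
    {Ls : ℕ → ℕ} (hLs : Tendsto Ls atTop atTop) {b : ℕ → ℝ} (hb0 : b 0 = 0) (hb : Monotone b) (N : ℕ)
    {ecap : ℕ → ℝ}
    (hcap : ∀ i < N, ∀ (ω : InfVolFermionState 2) (Ls' : ℕ → ℕ), Tendsto Ls' atTop atTop →
      ω.IsTorusLimitOfMixture (sectorGibbsCount n) (fun L => sectorGibbsWeightTT' (b i) t t' U n L)
        (fun L => sectorGibbsVectorTT' t t' U n L) Ls' →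
      ω.meanEnergy (hubbardTTPrimeFermionInteraction t t' U) 1 ≤ ecap i)
    {ε : ℝ} (hε : 0 < ε) :
    ∀ᶠ j in atTop, (2 * Real.binEntropy (n / 2) - ∑ i ∈ Finset.range N, (b (i + 1) - b i) * ecap i - ε) *
        (Ls j : ℝ) ^ 2 ≤
      Real.log (partitionFn (b N) (sectorHamiltonianTT' t t' U n (Ls j))).re :=
  eventually_pressureFloor_staircase t t' U hn0 hn2 hLs (le_of_eq hb0.symm) hb N hcap
    (fun δ hδ => by
      have h := eventually_pressureFloor_zero t t' U hn0 hn2 hLs hδ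
      rw [hb0]
      exact h) hε

end Literature.MathematicalPhysics.QuantumLattice

end
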